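import Literature.MathematicalPhysics.QuantumFieldTheory.Balaban1983to89.B9Thm312WholeH

/-!
# `Balaban1983to89.B9CoRealizesHRel` — the (3.133) co-reading of the H-kernels RELATIVE TO A BLOCK EQUIVALENCE on the output sites (the repair of
# `B9Thm312WholeH.CoRealizesH` forced by «sites = index bonds»), and the two (3.133) sup members read through it

T. Bałaban, *Propagators for lattice gauge theories in a background field*, Commun. Math. Phys. **99** (1985) 389–434
[`Balaban1985BackgroundPropagators`, "B9"]; [4] = T. Bałaban, *Propagators and renormalization transformations for lattice gauge
theories. II*, Commun. Math. Phys. **96** (1984) 223–250 [`Balaban1984PropagatorsII`].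

statement-level skeleton of published theorems with citation tags; proofs where landed; nothing here is a claim about the
Yang–Mills mass gap

THE PRINTED LOCI.  (3.133) p. 422 *"|H(x, y′)|, |(∇_UH)(x, y′)| ≦ B₀(L^jη∕L^{j′}η)²(L^{j′}η)^{−d}e^{−δ₀d(y,y′)}[1, (L^jη)^{−1}] … for x ∈ Δ(y)"*; p. 398 (the remark
after (3.47): the scale transfer of Lemma 2.1).

WHY THIS FILE (companion of `B9CoRealizesRel`).  `B9Thm312WholeH.CoRealizesH Hk n U d bu bv A` reads «x ∈ Δ(y)» on the OUTPUT lattice as the equality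
`bu x = y`.  At the geometry of record the output sites are index bonds, several per block, so — exactly as for n06-c's `CoRealizes`
(`B9CoRealizesSharedBlock`) — the reading `Hk.e n U y y′` (a sup over the whole carrier block of y) cannot be discharged from a bound on the fibre
`bu⁻¹(y)` alone.  THIS FILE relaxes the output condition to `Rel (bu x) y` for a block equivalence `Rel` (equality recovers `CoRealizesH`,
`coRealizesHRel_eq_iff`); the INPUT side stays pointwise (the test vectors of (3.133) live at ONE coarse point y′ — at the record the input lattice
IS the index bonds).  No multiplicity enters: only the saturation of the majorant in the output argument.
* §1 `CoRealizesHRel`, `coRealizesHRel_eq_iff`, ★ `hk_le_of_hasMajorantHom_rel` (majorant K′ saturated in the first argument ⇒ `Hk.e n U y y′ ≦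
  K′(y,y′)(L^{j′}η)^{−d}`).
* §2 ★ `hk_e0_of_hasMaj_rel`, ★ `hk_e1_of_hasMaj_rel` — the two (3.133) sup members from the leaf's entries H : Z² → 𝔠⁽²⁾, ∇_UH : Z² → 𝔠_Y⁽¹⁾ (verbatim the
  route of `B9Thm312WholeH.hk_e0_of_hasMaj` ∕ `hk_e1_of_hasMaj`: the class ratio transferred by [4] (2.60)), given that `Rel`-equivalent sites have
  the same distance to every site (`hRdist`) and the same scale length (`hRlen`) — true at the record for «same carrier block»
  (`B9CoRealizesRelAtLetters.dist_eq_of_relB` ∕ `len_eq_of_relB`).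

HONEST SCOPE.  A hypothesis schema of definitional shape and its bookkeeping consumers; nothing of [B9] asserted; count-neutral; N06 NOT discharged;
nothing continuum, nothing about the mass gap.  Cell `pub-ymgap` (HUMAN RULING D-0062), Track A node N06 [B9], seat `pub-ymgap-dag-n06-l` (g3), 2026-08-27.
-/

namespace Literature.MathematicalPhysics.QuantumFieldTheory.Balaban1983to89.B9CoRealizesHRel

open Literature.MathematicalPhysics.QuantumFieldTheory.Balaban1983to89
open Finset B6RandomWalk B6RandomWalkHom B9Thm34Ext B9Thm37GlueCor36 B11SectG B9SectDSup
open B9Thm37AllNorms B9Thm37AllNormsInstances B9FromB6 B9FromB6ModelSignsOn B9Thm312Whole B9Thm312WholeLeaf B9Thm312WholeLeft B9Thm312WholeH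

noncomputable section

section Schema

variable {g : B9.Geometry} {B : B9.Backgrounds} {X Y Z : Type}
variable [Fintype X] [Fintype Y] [Fintype Z] [Fintype g.Site]

/-- **CO-READING OF THE n-TH SUP MEMBER OF (3.133) BY A MODEL OPERATOR, OUTPUT RELATIVE TO A BLOCK EQUIVALENCE** (the repaired `CoRealizesH`): `Hk.e n U y y′`
is BELOW c whenever |(A b)(x)| ≦ c·(L^{j′}η)^d for every test vector b living at the coarse point y′ (|b| ≦ 1, b = 0 off the fibre `bv⁻¹(y′)`) and
every output point x whose site is `Rel`-EQUIVALENT to y.  `Rel := Eq` recovers `B9Thm312WholeH.CoRealizesH`.  A hypothesis schema; nothing asserted.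
[cite: Balaban1985BackgroundPropagators, (3.133) p.422 + (3.126) p.420] -/
structure CoRealizesHRel {u v : Type} (Hk : B9.HKernel g B) (n : Fin 2) (U : B.Cfg) (d : ℕ) (Rel : g.Site → g.Site → Prop)
    (bu : u → g.Site) (bv : v → g.Site) (A : (v → ℝ) →ₗ[ℝ] (u → ℝ)) : Prop where
  obs : ∀ (y y' : g.Site) (c : ℝ), 0 ≤ c →
    (∀ b : v → ℝ, (∀ x', bv x' ≠ y' → b x' = 0) → (∀ x', |b x'| ≤ 1) → ∀ x : u, Rel (bu x) y → |A b x| ≤ c * (g.len y') ^ (d : ℝ)) →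
      Hk.e n U y y' ≤ c

omit [Fintype X] [Fintype Y] [Fintype Z] [Fintype g.Site] in
/-- with the EQUALITY relation the relative H-co-reading IS `CoRealizesH`. [cite: Balaban1985BackgroundPropagators, (3.133) p.422, bookkeeping] -/
theorem coRealizesHRel_eq_iff {u v : Type} (Hk : B9.HKernel g B) (n : Fin 2) (U : B.Cfg) (d : ℕ) (bu : u → g.Site) (bv : v → g.Site)
    (A : (v → ℝ) →ₗ[ℝ] (u → ℝ)) : CoRealizesHRel Hk n U d Eq bu bv A ↔ CoRealizesH Hk n U d bu bv A :=
  ⟨fun h => ⟨h.obs⟩, fun h => ⟨h.obs⟩⟩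

omit [Fintype X] [Fintype Y] [Fintype Z] in
/-- ★ **[4]-(2.51) majorant SATURATED IN THE OUTPUT ARGUMENT + relative H-co-reading ⇒ the kernel bound** `Hk.e n U y y′ ≦ K′(y, y′)·(L^{j′}η)^{−d}`.
[cite: Balaban1985BackgroundPropagators, (3.133) p.422; Balaban1984PropagatorsII, (2.51) p.232] -/
theorem hk_le_of_hasMajorantHom_rel {u v : Type} {Hk : B9.HKernel g B} {n : Fin 2} {U : B.Cfg} {d : ℕ} {Rel : g.Site → g.Site → Prop}
    {bu : u → g.Site} {bv : v → g.Site} {A : (v → ℝ) →ₗ[ℝ] (u → ℝ)} {R₀ : ℝ} {H₀ : Prop} (hC : CoRealizesHRel Hk n U d Rel bu bv A)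
    (hlen : ∀ y : g.Site, 0 < g.len y) {K' : g.Site → g.Site → ℝ} (hK' : ∀ a b, 0 ≤ K' a b)
    (hsat : ∀ a a' b, Rel a a' → K' a b = K' a' b)
    (hA : HasMajorantHom (g := toB6 g R₀ H₀) bv bu A K') (y y' : g.Site) :
    Hk.e n U y y' ≤ K' y y' * (g.len y') ^ (-(d : ℝ)) := by
  refine hC.obs y y' _ (mul_nonneg (hK' y y') (Real.rpow_nonneg (hlen y').le _)) fun b hoff hb x hx => ?_
  have hbs : BlockSupp (g := toB6 g R₀ H₀) bv b y' 1 := ⟨zero_le_one, fun x' _ => hb x', hoff⟩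
  have h := hA y' b 1 hbs x
  rw [mul_one, hsat _ _ _ hx] at h
  calc |A b x| ≤ K' y y' := h
    _ = K' y y' * (g.len y') ^ (-(d : ℝ)) * (g.len y') ^ (d : ℝ) := by
        rw [mul_assoc, ← Real.rpow_add (hlen y'), neg_add_cancel, Real.rpow_zero, mul_one]

end Schema

/-! ## §2 ★ The two (3.133) sup members through the relative co-reading -/

section Members

variable {g : B9.Geometry} {B : B9.Backgrounds} {X Y Z : Type}
variable [Fintype X] [Fintype Y] [Fintype Z] [Fintype g.Site]

omit [Fintype Y] in
/-- ★ **(3.133), MEMBER n = 0, THROUGH THE RELATIVE CO-READING** (verbatim the route of `B9Thm312WholeH.hk_e0_of_hasMaj`; the only extra inputs are `hRdist`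
— `Rel`-equivalent sites have the same distances — and the use of `hk_le_of_hasMajorantHom_rel`).
[cite: Balaban1985BackgroundPropagators, (3.133) p.422 + p.398 (remark after (3.47)); Balaban1984PropagatorsII, (2.60) p.234] -/
theorem hk_e0_of_hasMaj_rel {R₀ : ℝ} {H₀ : Prop} (hG : GeoOK g) {Hk : B9.HKernel g B} {U : B.Cfg} {d : ℕ} {Rel : g.Site → g.Site → Prop}
    {blk : X → g.Site} {blkZ : Z → g.Site} {Hop : (Z → ℝ) →ₗ[ℝ] (X → ℝ)} {K ρ α Λ : ℝ} (hK0 : 0 ≤ K) (hΛ : 0 ≤ Λ)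
    (hC : CoRealizesHRel Hk 0 U d Rel blk blkZ Hop) (hRdist : ∀ a a' b, Rel a a' → g.dist a b = g.dist a' b)
    (hST : B9Ineq347.ScaleTransfer g ρ α Λ (fun y => g.len y ^ (2 : ℝ)))
    (hH : HasMaj (cNorm R₀ H₀ blkZ hG.lenle 2) (cNorm R₀ H₀ blk hG.lenle 2) Hop (fun a b => K * Real.exp (-(ρ * g.dist a b)))) :
    ∀ y y' : g.Site, Hk.e 0 U y y' ≤ K * Λ * (g.len y') ^ (-(d : ℝ)) * Real.exp (-((1 - α) * ρ * g.dist y y')) := by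
  intro y y'
  have h' := hasMajorantHom_of_hasMaj_cNorm hG (fun a b => mul_nonneg hK0 (Real.exp_nonneg _)) hH
  have hbound : ∀ a b : g.Site, K * Real.exp (-(ρ * g.dist a b)) * g.len a ^ 2 * wt g 2 b ≤
      K * Λ * Real.exp (-((1 - α) * ρ * g.dist a b)) := by
    intro a b
    have hb : 0 < g.len b := hG.lenpos b
    have ht := hST b a
    rw [hG.symm b a] at ht
    have hsplit : Real.exp (-((1 - α) * ρ * g.dist a b)) = Real.exp (-(ρ * g.dist a b)) * Real.exp (α * ρ * g.dist a b) := by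
      rw [← Real.exp_add]; congr 1; ring
    have h2 : g.len a ^ 2 * wt g 2 b ≤ Λ * Real.exp (α * ρ * g.dist a b) := by
      have hw : wt g 2 b = (g.len b ^ (2 : ℝ))⁻¹ := by simp [wt]
      rw [hw, ← Real.rpow_two, ← div_eq_mul_inv, div_le_iff₀ (Real.rpow_pos_of_pos hb _)]
      have := mul_le_mul_of_nonneg_left ht (Real.exp_pos (α * ρ * g.dist a b)).le
      calc g.len a ^ (2 : ℝ) = Real.exp (α * ρ * g.dist a b) * (Real.exp (-(α * ρ * g.dist a b)) * g.len a ^ (2 : ℝ)) := by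
            rw [← mul_assoc, ← Real.exp_add, add_neg_cancel, Real.exp_zero, one_mul]
        _ ≤ Real.exp (α * ρ * g.dist a b) * (Λ * g.len b ^ (2 : ℝ)) := this
        _ = Λ * Real.exp (α * ρ * g.dist a b) * g.len b ^ (2 : ℝ) := by ring
    calc K * Real.exp (-(ρ * g.dist a b)) * g.len a ^ 2 * wt g 2 b
        = K * Real.exp (-(ρ * g.dist a b)) * (g.len a ^ 2 * wt g 2 b) := by ring
      _ ≤ K * Real.exp (-(ρ * g.dist a b)) * (Λ * Real.exp (α * ρ * g.dist a b)) :=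
          mul_le_mul_of_nonneg_left h2 (mul_nonneg hK0 (Real.exp_nonneg _))
      _ = K * Λ * Real.exp (-((1 - α) * ρ * g.dist a b)) := by rw [hsplit]; ring
  have hA := hasMajorantHom_mono (g := toB6 g R₀ H₀) blkZ blk h' hbound
  have h := hk_le_of_hasMajorantHom_rel hC hG.lenpos (fun a b => mul_nonneg (mul_nonneg hK0 hΛ) (Real.exp_nonneg _))
    (fun a a' b hr => by rw [hRdist a a' b hr]) hA y y'
  calc Hk.e 0 U y y' ≤ K * Λ * Real.exp (-((1 - α) * ρ * g.dist y y')) * (g.len y') ^ (-(d : ℝ)) := h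
    _ = K * Λ * (g.len y') ^ (-(d : ℝ)) * Real.exp (-((1 - α) * ρ * g.dist y y')) := by ring

/-- ★ **(3.133), MEMBER n = 1, THROUGH THE RELATIVE CO-READING** (route of `B9Thm312WholeH.hk_e1_of_hasMaj`; extra inputs `hRdist`, `hRlen`).
[cite: Balaban1985BackgroundPropagators, (3.133) p.422 + p.398 (remark after (3.47)); Balaban1984PropagatorsII, (2.60) p.234] -/
theorem hk_e1_of_hasMaj_rel {R₀ : ℝ} {H₀ : Prop} (hG : GeoOK g) {Hk : B9.HKernel g B} {U : B.Cfg} {d : ℕ} {Rel : g.Site → g.Site → Prop}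
    {blkY : Y → g.Site} {blkZ : Z → g.Site} {DHop : (Z → ℝ) →ₗ[ℝ] (Y → ℝ)} {K ρ α Λ : ℝ} (hK0 : 0 ≤ K) (hΛ : 0 ≤ Λ)
    (hC : CoRealizesHRel Hk 1 U d Rel blkY blkZ DHop) (hRdist : ∀ a a' b, Rel a a' → g.dist a b = g.dist a' b)
    (hRlen : ∀ a a', Rel a a' → g.len a = g.len a')
    (hST : B9Ineq347.ScaleTransfer g ρ α Λ (fun y => g.len y ^ (2 : ℝ)))
    (hH : HasMaj (cNorm R₀ H₀ blkZ hG.lenle 2) (cNorm R₀ H₀ blkY hG.lenle 1) DHop (fun a b => K * Real.exp (-(ρ * g.dist a b)))) :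
    ∀ y y' : g.Site, Hk.e 1 U y y' ≤ K * Λ * (g.len y)⁻¹ * (g.len y') ^ (-(d : ℝ)) * Real.exp (-((1 - α) * ρ * g.dist y y')) := by
  intro y y'
  have h' := hasMajorantHom_of_hasMaj_cNorm hG (fun a b => mul_nonneg hK0 (Real.exp_nonneg _)) hH
  have hbound : ∀ a b : g.Site, K * Real.exp (-(ρ * g.dist a b)) * g.len a ^ 1 * wt g 2 b ≤
      K * Λ * (g.len a)⁻¹ * Real.exp (-((1 - α) * ρ * g.dist a b)) := by
    intro a b
    have ha : 0 < g.len a := hG.lenpos a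
    have hb : 0 < g.len b := hG.lenpos b
    have ht := hST b a
    rw [hG.symm b a] at ht
    have hsplit : Real.exp (-((1 - α) * ρ * g.dist a b)) = Real.exp (-(ρ * g.dist a b)) * Real.exp (α * ρ * g.dist a b) := by
      rw [← Real.exp_add]; congr 1; ring
    have h2 : g.len a ^ 2 * wt g 2 b ≤ Λ * Real.exp (α * ρ * g.dist a b) := by
      have hw : wt g 2 b = (g.len b ^ (2 : ℝ))⁻¹ := by simp [wt]
      rw [hw, ← Real.rpow_two, ← div_eq_mul_inv, div_le_iff₀ (Real.rpow_pos_of_pos hb _)]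
      have := mul_le_mul_of_nonneg_left ht (Real.exp_pos (α * ρ * g.dist a b)).le
      calc g.len a ^ (2 : ℝ) = Real.exp (α * ρ * g.dist a b) * (Real.exp (-(α * ρ * g.dist a b)) * g.len a ^ (2 : ℝ)) := by
            rw [← mul_assoc, ← Real.exp_add, add_neg_cancel, Real.exp_zero, one_mul]
        _ ≤ Real.exp (α * ρ * g.dist a b) * (Λ * g.len b ^ (2 : ℝ)) := this
        _ = Λ * Real.exp (α * ρ * g.dist a b) * g.len b ^ (2 : ℝ) := by ring
    have h1 : g.len a ^ 1 * wt g 2 b = (g.len a)⁻¹ * (g.len a ^ 2 * wt g 2 b) := by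
      rw [pow_one]; field_simp
    calc K * Real.exp (-(ρ * g.dist a b)) * g.len a ^ 1 * wt g 2 b
        = K * Real.exp (-(ρ * g.dist a b)) * (g.len a)⁻¹ * (g.len a ^ 2 * wt g 2 b) := by rw [mul_assoc (K * _), h1, ← mul_assoc]
      _ ≤ K * Real.exp (-(ρ * g.dist a b)) * (g.len a)⁻¹ * (Λ * Real.exp (α * ρ * g.dist a b)) :=
          mul_le_mul_of_nonneg_left h2 (mul_nonneg (mul_nonneg hK0 (Real.exp_nonneg _)) (inv_nonneg.mpr ha.le))
      _ = K * Λ * (g.len a)⁻¹ * Real.exp (-((1 - α) * ρ * g.dist a b)) := by rw [hsplit]; ring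
  have hA := hasMajorantHom_mono (g := toB6 g R₀ H₀) blkZ blkY h' hbound
  have h := hk_le_of_hasMajorantHom_rel hC hG.lenpos
    (fun a b => mul_nonneg (mul_nonneg (mul_nonneg hK0 hΛ) (inv_nonneg.mpr (hG.lenpos a).le)) (Real.exp_nonneg _))
    (fun a a' b hr => by rw [hRdist a a' b hr, hRlen a a' hr]) hA y y'
  calc Hk.e 1 U y y' ≤ K * Λ * (g.len y)⁻¹ * Real.exp (-((1 - α) * ρ * g.dist y y')) * (g.len y') ^ (-(d : ℝ)) := h
    _ = K * Λ * (g.len y)⁻¹ * (g.len y') ^ (-(d : ℝ)) * Real.exp (-((1 - α) * ρ * g.dist y y')) := by ring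

end Members

end

end Literature.MathematicalPhysics.QuantumFieldTheory.Balaban1983to89.B9CoRealizesHRel
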